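import Literature.NumberTheory.Automorphic.ArchRankOneSplitOrbitContinuityJoint      -- ★ p850218 (F0P3a-p05 (g19)): the joint `(x, θ)` form; brings ★ FILE 2 p850189 (`abs_sub_smul_integral_descConj_hypBlockGL_eq_smul_integral_prod`, `integral_prod_conj_hypBlockGL_half_zero`, `hypBlockGL_mem_of_eq_over`)
import HarnessLib

/-!
# (A0), PARAMETRIC JOINT FORM: the Weyl-normalised split orbital integral of `U(Φ₂)(ℂ)` at `hypBlockGL x θ` of a test function `F_q` DEPENDING CONTINUOUSLY ON A
# PARAMETER `q` tends to `C · ∫_{K × N} F_{q₀}(e^{iθ₀} · k n k⁻¹)` as `(q, x, θ) → (q₀, 0, θ₀)` within `{x ≠ 0}` (Varadarajan 1989 §6.4 Thm 23; Shelstad 1979 Lemma 4.3)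

Topic `NumberTheory/Automorphic`; namespace `Literature.NumberTheory.Automorphic.UnitaryGroup`.  KERNEL mathematics only: theorems, no definition, no named fact, no instance, no
notation, no `sorry`.  Cell `pub/hodgecm-mathlib`, line LH3 (closer stub `stub_N9`, crux H413 = `stmt-HodgeConjecture-24833`), DIRECT ROAD N9″, organ J, brick **(L-d) «PARAM-JOINT»**
(F0P3b-p01 (g15), 2026-09-02T08:00Z finding on (NONDEG-G′)'s critical path): the PARAMETRIC sequel to ★ `ArchRankOneSplitOrbitContinuityJoint` (F0P3a-p05 (g19)), whose head is joint in
`(x, θ)` for ONE FIXED test function `F`.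

WHY.  The (JG′) conjunct `orbFamGExt L α ν′ a′ (insert w S) (hcCayPt w 0 2 s) ≠ 0` of organ J reads the wall-extended genuine family ★ `orbFamGExt` at a Cayley point, i.e. Mathlib's
`extendFrom (RegG (insert w S))` = `limUnder (𝓝[RegG] hcCayPt)` of the raw family: a junk value unless the limit along the FULL filter `𝓝[RegG (insert w S)] hcCayPt` exists
((G′-CAY-LIM)).  Along that filter ALL chart coordinates move; after the descent (★ D2∕D4b) and the unfolding of `Z(s) ≃ Block × K` ((M-UNFOLD)) the rank-one block integral reads a
test function `F_q(u) = (a′)_M(e_M⁻¹(cay u, q))` whose SPECTATOR component `q ∈ K` (slot `τ₀1` at `w₀`, every `w ≠ w₀`) moves with the chart point.  Hence the (A0) limit must be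
taken jointly in `(q, x, θ)` — this file — not only in `(x, θ)`.

THE MATHEMATICS (as ★ p850218, one more variable).  `G = U(conj, J)(ℂ)`, `hJ : J = (StdForm.antidiagonal 2).over ℂ`, `T` the split torus, `N` the unipotent radical, `K ≤ G` compact,
`κ`, `μ_N` Haar, `μ = C • ((k, n) ↦ k n T)_*(κ ⊗ μ_N)` on `G ⧸ T`.  For a parameter space `P` (first countable, locally compact) and `F : P → G → E` JOINTLY continuous with ONE compact
`S₀ ⊆ G` off which every `F_q` vanishes: (§1) `(q, x, θ) ↦ ∫_{K × N} F_q(k · (e^{iθ}·1 · a(x) n a(x)) · k⁻¹) d(κ ⊗ μ_N)`, `a(x) = hypBlockGL (x∕2) 0`, is continuous on `P × ℝ × ℝ`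
(jointly continuous integrand; for `(q, x, θ)` in a compact box the integrand is supported in a fixed compact of `K × N`; Mathlib `continuous_parametric_integral_of_continuous`);
(§2) with ★ `abs_sub_smul_integral_descConj_hypBlockGL_eq_smul_integral_prod` (the identity off the centre, for each `F_q`) and ★ `integral_prod_conj_hypBlockGL_half_zero` (the value
at the centre): **`|eˣ − e⁻ˣ| • ∫_{G ⧸ T} F_q(y · hypBlockGL x θ · y⁻¹) dμ(y) ⟶ C • ∫_{K × N} F_{q₀}(e^{iθ₀} · k n k⁻¹) d(κ ⊗ μ_N)`** as `(q, x, θ) → (q₀, 0, θ₀)` within `{x ≠ 0}`.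
HONEST LABEL: HC_CM is proved only modulo the 7 printed citations (2 remaining named inputs: hLiu418 = `stmt-HodgeConjecture-24832`, h413 = `stmt-HodgeConjecture-24833`) until rung 0
closes; count-neutral analysis, pays nothing by itself.

## References
* [Varadarajan1989] V. S. Varadarajan, *An Introduction to Harmonic Analysis on Semisimple Lie Groups*, Cambridge Stud. Adv. Math. 16 (1989), §6.4 Lemma 21, Thm 23.
* [Shelstad1979] D. Shelstad, *Characters and inner forms of a quasi-split group over ℝ*, Compositio Math. 39 (1979) 11–45, §4 Lemma 4.3 p. 25.
* [Rogawski1990] J. D. Rogawski, *Automorphic Representations of Unitary Groups in Three Variables*, Ann. of Math. Stud. 123 (1990), §8.2 p. 119.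
-/

set_option autoImplicit false

noncomputable section

open MeasureTheory Measure Set Filter Topology
open scoped ENNReal NNReal ComplexConjugate

namespace Literature.NumberTheory.Automorphic

open Literature.MeasureTheory.Group

namespace UnitaryGroup

open Literature.NumberTheory.Automorphic.UnitaryGroup.HeisRing Literature.NumberTheory.Automorphic.UnitaryGroup.LineRing

section SplitChartParam

variable {J : Matrix (Fin 2) (Fin 2) ℂ} (hJ : J = (StdForm.antidiagonal 2).over ℂ)
  [MeasurableSpace ↥(unitaryGroupOfForm (starRingEnd ℂ) J)] [BorelSpace ↥(unitaryGroupOfForm (starRingEnd ℂ) J)]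
  {K : Subgroup ↥(unitaryGroupOfForm (starRingEnd ℂ) J)} (κ : Measure ↥K)
  (μN : Measure ↥(unipotentU (starRingEnd ℂ) J)) {E : Type*} [NormedAddCommGroup E] [NormedSpace ℝ E]
  {P : Type*} [TopologicalSpace P] [FirstCountableTopology P] [LocallyCompactSpace P]

/-! ## §1 Joint continuity of the chart integral in `(q, x, θ)` -/

include hJ in
/-- **(A0), JOINT CONTINUITY OF THE CHART in `(q, x, θ)` for a parametrised test function.**  For `K` compact, `κ`, `μ_N` Haar, `F : P → G → E` jointly continuous with all
`F_q` supported in one compact `S₀`: `(q, x, θ) ↦ ∫_{K × N} F_q(k · (hypBlockGL 0 θ · a(x) n a(x)) · k⁻¹) d(κ ⊗ μ_N)`, `a(x) = hypBlockGL (x∕2) 0`, is continuous on `P × ℝ × ℝ`.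
[cite: Varadarajan1989, §6.4 Thm 23] [cite: Shelstad1979, Lemma 4.3 p. 25] -/
theorem continuous_integral_prod_conj_hypBlockGL_half_param (hK : IsCompact (K : Set ↥(unitaryGroupOfForm (starRingEnd ℂ) J)))
    [IsHaarMeasure κ] [IsHaarMeasure μN] (F : P → ↥(unitaryGroupOfForm (starRingEnd ℂ) J) → E) (hF : Continuous (Function.uncurry F))
    {S₀ : Set ↥(unitaryGroupOfForm (starRingEnd ℂ) J)} (hS₀ : IsCompact S₀) (hFS : ∀ q g, g ∉ S₀ → F q g = 0) :
    Continuous fun qxθ : P × ℝ × ℝ => ∫ p : ↥K × ↥(unipotentU (starRingEnd ℂ) J),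
        F qxθ.1 ((p.1 : ↥(unitaryGroupOfForm (starRingEnd ℂ) J)) *
          ((⟨hypBlockGL 0 qxθ.2.2, hypBlockGL_mem_of_eq_over hJ 0 qxθ.2.2⟩ : ↥(unitaryGroupOfForm (starRingEnd ℂ) J)) *
            (⟨hypBlockGL (qxθ.2.1 / 2) 0, hypBlockGL_mem_of_eq_over hJ (qxθ.2.1 / 2) 0⟩ : ↥(unitaryGroupOfForm (starRingEnd ℂ) J)) *
            (p.2 : ↥(unitaryGroupOfForm (starRingEnd ℂ) J)) *
            (⟨hypBlockGL (qxθ.2.1 / 2) 0, hypBlockGL_mem_of_eq_over hJ (qxθ.2.1 / 2) 0⟩ : ↥(unitaryGroupOfForm (starRingEnd ℂ) J))) *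
          (p.1 : ↥(unitaryGroupOfForm (starRingEnd ℂ) J))⁻¹) ∂(κ.prod μN) := by
  haveI : LocallyCompactSpace ↥(unitaryGroupOfForm (starRingEnd ℂ) J) := locallyCompactSpace_unitaryGroupOfForm_complex J
  haveI : SecondCountableTopology ↥(unitaryGroupOfForm (starRingEnd ℂ) J) := secondCountableTopology_unitaryGroupOfForm_complex J
  have hN : IsClosed (unipotentU (starRingEnd ℂ) J : Set ↥(unitaryGroupOfForm (starRingEnd ℂ) J)) := isClosed_unipotentU _ _
  haveI : LocallyCompactSpace ↥(unipotentU (starRingEnd ℂ) J) := hN.isClosedEmbedding_subtypeVal.locallyCompactSpace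
  haveI : SecondCountableTopology ↥(unipotentU (starRingEnd ℂ) J) := TopologicalSpace.Subtype.secondCountableTopology _
  haveI : SecondCountableTopology ↥K := TopologicalSpace.Subtype.secondCountableTopology _
  haveI : BorelSpace ↥(unipotentU (starRingEnd ℂ) J) := Subtype.borelSpace _
  haveI : BorelSpace ↥K := Subtype.borelSpace _
  haveI : BorelSpace (↥K × ↥(unipotentU (starRingEnd ℂ) J)) := Prod.borelSpace
  haveI : CompactSpace ↥K := isCompact_iff_compactSpace.1 hK
  haveI : LocallyCompactSpace ↥K := hK.isClosed.isClosedEmbedding_subtypeVal.locallyCompactSpace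
  -- the moving torus element `a(x)` and the moving centre `z(θ)`, as functions of the full parameter `(q, x, θ)`
  obtain ⟨z, hz⟩ : ∃ z : P × ℝ × ℝ → ↥(unitaryGroupOfForm (starRingEnd ℂ) J),
      z = fun qxθ => ⟨hypBlockGL 0 qxθ.2.2, hypBlockGL_mem_of_eq_over hJ 0 qxθ.2.2⟩ := ⟨_, rfl⟩
  obtain ⟨a, ha⟩ : ∃ a : P × ℝ × ℝ → ↥(unitaryGroupOfForm (starRingEnd ℂ) J),
      a = fun qxθ => ⟨hypBlockGL (qxθ.2.1 / 2) 0, hypBlockGL_mem_of_eq_over hJ (qxθ.2.1 / 2) 0⟩ := ⟨_, rfl⟩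
  have hzc : Continuous z := by
    rw [hz]
    exact (continuous_hypBlockGL.comp (continuous_const.prodMk (continuous_snd.comp continuous_snd))).subtype_mk _
  have hac : Continuous a := by
    rw [ha]
    exact (continuous_hypBlockGL.comp (((continuous_fst.comp continuous_snd).div_const 2).prodMk continuous_const)).subtype_mk _
  -- the integrand as a function of `(qxθ, p)`
  obtain ⟨f, hf⟩ : ∃ f : P × ℝ × ℝ → ↥K × ↥(unipotentU (starRingEnd ℂ) J) → E, f = fun qxθ p =>
      F qxθ.1 ((p.1 : ↥(unitaryGroupOfForm (starRingEnd ℂ) J)) * (z qxθ * a qxθ * (p.2 : ↥(unitaryGroupOfForm (starRingEnd ℂ) J)) * a qxθ) *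
        (p.1 : ↥(unitaryGroupOfForm (starRingEnd ℂ) J))⁻¹) := ⟨_, rfl⟩
  have hgoal : (fun qxθ : P × ℝ × ℝ => ∫ p : ↥K × ↥(unipotentU (starRingEnd ℂ) J),
        F qxθ.1 ((p.1 : ↥(unitaryGroupOfForm (starRingEnd ℂ) J)) *
          ((⟨hypBlockGL 0 qxθ.2.2, hypBlockGL_mem_of_eq_over hJ 0 qxθ.2.2⟩ : ↥(unitaryGroupOfForm (starRingEnd ℂ) J)) *
            (⟨hypBlockGL (qxθ.2.1 / 2) 0, hypBlockGL_mem_of_eq_over hJ (qxθ.2.1 / 2) 0⟩ : ↥(unitaryGroupOfForm (starRingEnd ℂ) J)) *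
            (p.2 : ↥(unitaryGroupOfForm (starRingEnd ℂ) J)) *
            (⟨hypBlockGL (qxθ.2.1 / 2) 0, hypBlockGL_mem_of_eq_over hJ (qxθ.2.1 / 2) 0⟩ : ↥(unitaryGroupOfForm (starRingEnd ℂ) J))) *
          (p.1 : ↥(unitaryGroupOfForm (starRingEnd ℂ) J))⁻¹) ∂(κ.prod μN)) = fun qxθ => ∫ p, f qxθ p ∂(κ.prod μN) := by
    rw [hf, ha, hz]
  rw [hgoal]
  have hfc : Continuous f.uncurry := by
    rw [hf]
    have h0 : Continuous fun q : (P × ℝ × ℝ) × (↥K × ↥(unipotentU (starRingEnd ℂ) J)) => q.1.1 := continuous_fst.comp continuous_fst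
    have h1 : Continuous fun q : (P × ℝ × ℝ) × (↥K × ↥(unipotentU (starRingEnd ℂ) J)) => ((q.2.1 : ↥K) : ↥(unitaryGroupOfForm (starRingEnd ℂ) J)) :=
      continuous_subtype_val.comp (continuous_fst.comp continuous_snd)
    have h2 : Continuous fun q : (P × ℝ × ℝ) × (↥K × ↥(unipotentU (starRingEnd ℂ) J)) =>
        ((q.2.2 : ↥(unipotentU (starRingEnd ℂ) J)) : ↥(unitaryGroupOfForm (starRingEnd ℂ) J)) :=
      continuous_subtype_val.comp (continuous_snd.comp continuous_snd)
    have h3 : Continuous fun q : (P × ℝ × ℝ) × (↥K × ↥(unipotentU (starRingEnd ℂ) J)) => a q.1 := hac.comp continuous_fst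
    have h4 : Continuous fun q : (P × ℝ × ℝ) × (↥K × ↥(unipotentU (starRingEnd ℂ) J)) => z q.1 := hzc.comp continuous_fst
    exact hF.comp (h0.prodMk ((h1.mul (((h4.mul h3).mul h2).mul h3)).mul h1.inv))
  refine continuous_iff_continuousAt.2 fun p₀ => ?_
  -- a compact neighbourhood `V` of the parameter `p₀.1` and the box `[x₀ − 1, x₀ + 1] × [θ₀ − 1, θ₀ + 1]`
  obtain ⟨V, hVc, hVn⟩ := exists_compact_mem_nhds p₀.1
  obtain ⟨Ψ, hΨ⟩ : ∃ Ψ : (P × ℝ × ℝ) × ↥K × ↥(unitaryGroupOfForm (starRingEnd ℂ) J) → ↥(unitaryGroupOfForm (starRingEnd ℂ) J),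
      Ψ = fun q => (z q.1 * a q.1)⁻¹ * (((q.2.1 : ↥K) : ↥(unitaryGroupOfForm (starRingEnd ℂ) J))⁻¹ * q.2.2 *
        ((q.2.1 : ↥K) : ↥(unitaryGroupOfForm (starRingEnd ℂ) J))) * (a q.1)⁻¹ := ⟨_, rfl⟩
  have hΨc : Continuous Ψ := by
    rw [hΨ]
    have h1 : Continuous fun q : (P × ℝ × ℝ) × ↥K × ↥(unitaryGroupOfForm (starRingEnd ℂ) J) =>
        ((q.2.1 : ↥K) : ↥(unitaryGroupOfForm (starRingEnd ℂ) J)) := continuous_subtype_val.comp (continuous_fst.comp continuous_snd)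
    have h3 : Continuous fun q : (P × ℝ × ℝ) × ↥K × ↥(unitaryGroupOfForm (starRingEnd ℂ) J) => a q.1 := hac.comp continuous_fst
    have h4 : Continuous fun q : (P × ℝ × ℝ) × ↥K × ↥(unitaryGroupOfForm (starRingEnd ℂ) J) => z q.1 := hzc.comp continuous_fst
    exact ((h4.mul h3).inv.mul ((h1.inv.mul (continuous_snd.comp continuous_snd)).mul h1)).mul h3.inv
  set U : Set (P × ℝ × ℝ) := V ×ˢ (Icc (p₀.2.1 - 1) (p₀.2.1 + 1) ×ˢ Icc (p₀.2.2 - 1) (p₀.2.2 + 1)) with hU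
  have hUc : IsCompact U := hVc.prod (isCompact_Icc.prod isCompact_Icc)
  have hUn : U ∈ 𝓝 p₀ := by
    have hp₀ : p₀ = (p₀.1, (p₀.2.1, p₀.2.2)) := rfl
    rw [hp₀]
    exact prod_mem_nhds hVn (prod_mem_nhds (Icc_mem_nhds (by linarith) (by linarith)) (Icc_mem_nhds (by linarith) (by linarith)))
  set S₁ : Set ↥(unitaryGroupOfForm (starRingEnd ℂ) J) := Ψ '' (U ×ˢ (univ ×ˢ S₀)) with hS₁
  have hS₁c : IsCompact S₁ := ((hUc.prod (isCompact_univ.prod hS₀)).image hΨc)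
  set N₀ : Set ↥(unipotentU (starRingEnd ℂ) J) := Subtype.val ⁻¹' S₁ with hN₀
  have hN₀c : IsCompact N₀ := hN.isClosedEmbedding_subtypeVal.isCompact_preimage hS₁c
  set s : Set (↥K × ↥(unipotentU (starRingEnd ℂ) J)) := univ ×ˢ N₀ with hs
  have hsc : IsCompact s := isCompact_univ.prod hN₀c
  -- off `s` the integrand vanishes, for `(q, x, θ)` in `U`
  have hzero : ∀ qxθ ∈ U, ∀ p, p ∉ s → f qxθ p = 0 := by
    intro qxθ hx p hp
    rw [hf]
    by_contra hne
    apply hp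
    refine mk_mem_prod (mem_univ _) ?_
    change ((p.2 : ↥(unipotentU (starRingEnd ℂ) J)) : ↥(unitaryGroupOfForm (starRingEnd ℂ) J)) ∈ S₁
    have hmem : (p.1 : ↥(unitaryGroupOfForm (starRingEnd ℂ) J)) * (z qxθ * a qxθ * (p.2 : ↥(unitaryGroupOfForm (starRingEnd ℂ) J)) * a qxθ) *
        (p.1 : ↥(unitaryGroupOfForm (starRingEnd ℂ) J))⁻¹ ∈ S₀ := by
      by_contra hout
      exact hne (hFS qxθ.1 _ hout)
    refine ⟨(qxθ, p.1, (p.1 : ↥(unitaryGroupOfForm (starRingEnd ℂ) J)) * (z qxθ * a qxθ * (p.2 : ↥(unitaryGroupOfForm (starRingEnd ℂ) J)) * a qxθ) *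
      (p.1 : ↥(unitaryGroupOfForm (starRingEnd ℂ) J))⁻¹), mk_mem_prod hx (mk_mem_prod (mem_univ _) hmem), ?_⟩
    rw [hΨ]
    simp only
    group
  -- the parametric integral over the compact `s` is continuous, and agrees with ours near `p₀`
  have hcont : Continuous fun qxθ => ∫ p in s, f qxθ p ∂(κ.prod μN) := continuous_parametric_integral_of_continuous hfc hsc
  refine (hcont.continuousAt (x := p₀)).congr ?_
  filter_upwards [hUn] with qxθ hx
  exact setIntegral_eq_integral_of_forall_compl_eq_zero fun p hp => hzero qxθ hx p hp

/-! ## §2 The parametric joint head at `(q₀, 0, θ₀)` -/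

variable [MeasurableSpace (↥(unitaryGroupOfForm (starRingEnd ℂ) J) ⧸ torusU (starRingEnd ℂ) J)]
  [BorelSpace (↥(unitaryGroupOfForm (starRingEnd ℂ) J) ⧸ torusU (starRingEnd ℂ) J)]
  (μ : Measure (↥(unitaryGroupOfForm (starRingEnd ℂ) J) ⧸ torusU (starRingEnd ℂ) J))

include hJ in
/-- **(A0) HEAD, PARAMETRIC JOINT FORM — the limit at `(q₀, 0, θ₀)` in the parameter AND all chart coordinates.**  With `μ = C • ((k, n) ↦ k n T)_*(κ ⊗ μ_N)` on
`U(Φ₂)(ℂ) ⧸ T`, `K` compact, `F : P → G → E` jointly continuous with all `F_q` supported in one compact `S₀`: as `(q, x, θ) → (q₀, 0, θ₀)` within `{x ≠ 0}`,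
**`|eˣ − e⁻ˣ| • ∫_{G ⧸ T} F_q(y · hypBlockGL x θ · y⁻¹) dμ(y) ⟶ C • ∫_{K × N} F_{q₀}(e^{iθ₀} · k n k⁻¹) d(κ ⊗ μ_N)`** — the input of the Cayley limit (G′-CAY-LIM) of the genuine
family along `𝓝[RegG] hcCayPt`, where the descended block function's spectator component moves with the chart point.
[cite: Varadarajan1989, §6.4 Lemma 21, Thm 23] [cite: Shelstad1979, Lemma 4.3 p. 25] [cite: Rogawski1990, §8.2 p. 119] -/
theorem tendsto_abs_sub_smul_integral_descConj_hypBlockGL_param (hK : IsCompact (K : Set ↥(unitaryGroupOfForm (starRingEnd ℂ) J)))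
    [IsHaarMeasure κ] [IsHaarMeasure μN] {C : ℝ≥0}
    (hμC : μ = C • Measure.map
      (fun p : ↥K × ↥(unipotentU (starRingEnd ℂ) J) =>
        (QuotientGroup.mk ((p.1 : ↥(unitaryGroupOfForm (starRingEnd ℂ) J)) * (p.2 : ↥(unitaryGroupOfForm (starRingEnd ℂ) J))) :
          ↥(unitaryGroupOfForm (starRingEnd ℂ) J) ⧸ torusU (starRingEnd ℂ) J))
      (κ.prod μN))
    (F : P → ↥(unitaryGroupOfForm (starRingEnd ℂ) J) → E) (hF : Continuous (Function.uncurry F))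
    {S₀ : Set ↥(unitaryGroupOfForm (starRingEnd ℂ) J)} (hS₀ : IsCompact S₀) (hFS : ∀ q g, g ∉ S₀ → F q g = 0) (q₀ : P) (θ₀ : ℝ) :
    Tendsto (fun qxθ : P × ℝ × ℝ => |Real.exp qxθ.2.1 - Real.exp (-qxθ.2.1)| •
        ∫ y, descConj (⟨hypBlockGL qxθ.2.1 qxθ.2.2, hypBlockGL_mem_of_eq_over hJ qxθ.2.1 qxθ.2.2⟩ : ↥(unitaryGroupOfForm (starRingEnd ℂ) J))
          (torusU (starRingEnd ℂ) J) (LineRing.forall_mem_torusU_comm (starRingEnd ℂ) J (hypBlockGL_mem_torusU hJ qxθ.2.1 qxθ.2.2)) (F qxθ.1) y ∂μ)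
      (𝓝[{qxθ : P × ℝ × ℝ | qxθ.2.1 ≠ 0}] (q₀, 0, θ₀))
      (𝓝 ((C : ℝ) • ∫ p : ↥K × ↥(unipotentU (starRingEnd ℂ) J),
        F q₀ ((⟨hypBlockGL 0 θ₀, hypBlockGL_mem_of_eq_over hJ 0 θ₀⟩ : ↥(unitaryGroupOfForm (starRingEnd ℂ) J)) *
          ((p.1 : ↥(unitaryGroupOfForm (starRingEnd ℂ) J)) * (p.2 : ↥(unitaryGroupOfForm (starRingEnd ℂ) J)) *
            (p.1 : ↥(unitaryGroupOfForm (starRingEnd ℂ) J))⁻¹)) ∂(κ.prod μN))) := by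
  haveI : CompactSpace ↥K := isCompact_iff_compactSpace.1 hK
  have hcont := continuous_integral_prod_conj_hypBlockGL_half_param hJ κ μN hK F hF hS₀ hFS
  have h0 := integral_prod_conj_hypBlockGL_half_zero hJ κ μN (F q₀) θ₀ (K := K) (E := E)
  have hlim := ((hcont.tendsto (q₀, (0 : ℝ), θ₀)).const_smul (C : ℝ)).mono_left (nhdsWithin_le_nhds (s := {qxθ : P × ℝ × ℝ | qxθ.2.1 ≠ 0}))
  simp only at hlim
  rw [h0] at hlim
  refine hlim.congr' ?_
  filter_upwards [self_mem_nhdsWithin] with qxθ hx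
  have hFq : Continuous (F qxθ.1) := hF.comp (continuous_const.prodMk continuous_id)
  exact (abs_sub_smul_integral_descConj_hypBlockGL_eq_smul_integral_prod hJ κ μN μ hμC (F qxθ.1) hFq qxθ.2.2 hx).symm

end SplitChartParam

end UnitaryGroup

end Literature.NumberTheory.Automorphic

end
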